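import Summits.QuantumFields.QCD.Theorems.ExtinctionBuildsQCD.Negative.WithoutTightCollapse

/-!
# Negative knowledge for the RESTATED crux `ExtinctionBuildsQCD` (stmt-QuantumFields-18064,
# SD⁺ → THR): of the three clauses added by the restatement only the extensive pin TIGHT⁺ is
# junk-excluding — without TIGHT⁺ the bridge is its own conclusion `THR 2 ∧ THR 3`

Certified copy of §0⁺/§2⁺ of the cdisprove work file
`Summits/QuantumFields/QCD/Cruxes/ExtinctionBuildsQCD/Disproof.lean` (refuter, cdisprove seat on
stmt-18064, 2026-08-17). Supports stmt-QuantumFields-18064; asserts no route item.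

The restatement of 2026-08-17 (route-repair after `refuted-misstated` on stmt-17572) replaced the
hypothesis SD of the bridge by SD⁺ = SD ∧ (R1) polynomial volume cap `∃ p, ∀ᶠ k, L_k ≤ a_k^{-p}` ∧
(BRANCH) `∀ᶠ k, −1 < m_crit(k)` ∧ (R2) TIGHT⁺, the filed pin with floor `1` raised to
`max 1 (η (a_k(2L_k+1))²)`, and the conclusion `QCDOf N_f` by the threshold body THR.  The root
module `WithoutTightCollapse` (landed for stmt-8968) still types its three §0 shape theorems
(`extinctionBuildsQCD_iff`, `windowExtinction_iff`, `not_extinctionBuildsQCD_iff`) against the RETIRED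
bodies — they no longer elaborate from source and must not be used (append-only: superseded here by
the `_sdPlus` versions); its clause defs `Extinct`/`Tight`/`SDHyp` and §1–§2 are unaffected.  This
module records the shape of the restated crux and what each new clause buys against junk:

* §0⁺ SHAPE AND TRANSFER.  `ExtinctionBuildsQCD ↔ ∀ N_f ∈ {2,3}, SD⁺(N_f) → THR(N_f)`
  (`extinctionBuildsQCD_iff_sdPlus`, `Iff.rfl`; `TightPlus`, `SDPlusHyp`, `Threshold` definitional),
  `WindowExtinction ↔ ∀ N_f ∈ {2,3}, SD⁺(N_f)` (`windowExtinction_iff_sdPlus`), a kill needs an SD⁺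
  witness AND `¬ THR` (`not_extinctionBuildsQCD_iff_sdPlus`) — "no massive QCD above any threshold",
  summit-hard.  TIGHT⁺ ⇒ TIGHT (`tight_of_tightPlus`), SD⁺ ⇒ SD (`sdHyp_of_sdPlusHyp`,
  `sdHyp_of_windowExtinction`): every landed fact about SD-witnesses (`WithoutTightCollapse` §1–§2,
  `TightPinsLine`, `IndexBudget`, `WeylWindow`, `ExtinctIntegrable`, `CoercivityCeiling`, `TwoSidedPin`)
  applies verbatim to SD⁺-witnesses — line pinned into `[-8, 0]` (with BRANCH: `m_crit(k) ∈
  (−1, a_k M/Z_k]` eventually), `c ≤ 1`, index jumps = real modes of `D_W(U,0,1)`, two-sided pin at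
  the flavour mass.  `QCDOf N_f → THR N_f` (`threshold_of_qcdOf`).
* §2⁺ LOAD-BEARING.  The degenerate tree regularisation `canonicalAF` (`a_k = 1/(k+1)`, `L_k = (k+1)²`,
  `m_crit ≡ 0`, canonical `Z_m`) MEETS the cap with `p = 2` (`canonicalAF_cap`) and the branch clause
  (`canonicalAF_branch`); with `extinct_of_mcrit_nonneg` it inhabits SD⁺ minus TIGHT⁺
  (`sdPlusWithoutTight_canonicalAF`), so `ExtinctionBuildsQCDPlusWithoutTight ↔ THR 2 ∧ THR 3`
  (`extinctionBuildsQCDPlusWithoutTight_iff_threshold`) and, for EVERY replacement `P` of TIGHT⁺ met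
  by `canonicalAF`, the same collapse (`bridgePlus_collapse_schema`).  Cap and branch are therefore
  NOT junk-excluding on their own; any proof of the restated crux must extract its fermionic input
  from the extensive pin TIGHT⁺ (jointly with EXTINCT).  Given the sibling crux the bridge is
  equivalent to its conclusion (`extinctionBuildsQCD_iff_threshold_of_windowExtinction`).
* WHY TIGHT⁺ RESISTS A JUNK WITNESS (heuristic, recorded for the planner; no theorem): under the cap
  the index carriers of the tip family are real modes of `D_W(U,0,1)` in `(0, a_k M/Z_k]`, extended
  over `≳ Z_k/(a_k M)` sites and hosted only by cold patches of that size with local mass shift below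
  `a_k M/Z_k ≪ |m_c(β_k)| ≍ 0.87/β_k` — a Gaussian small-ball event of cost `exp(−C (Z/aM)⁴ β)`, so
  even the filed floor `1` fails on `≤ a_k^{−4p}` sites; for a line at depth `t* ∈ (0, 1)` EXTINCT
  (cumulative sub-line count on the whole scheme torus `→ 0`) and TIGHT (window count `≥ 1`) demand
  an EDGE of the real-mode depth distribution at `t*` sharp to `o(a_k/Z_k)`, and the only edges in
  sight are the tip `0` (dead under the cap) and the physical accumulation edge `|m_c(β)|` (honest).

References: Montvay–Münster 1994 §5.1; Leutwyler–Smilga 1992 / Smilga 2001 (16.9) (the `√(χ_t V)`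
scale behind TIGHT⁺); Edwards–Heller–Narayanan, Nucl. Phys. B 535 (1998) 403 (real-mode depth
distribution of `D_W`).
-/

noncomputable section

namespace Summit.QuantumFields.QCD.Theorems.ExtinctionBuildsQCD.Negative

open scoped BigOperators Topology Classical MeasureTheory Matrix ComplexConjugate
open Filter MeasureTheory Matrix
open Literature.MathematicalPhysics.QuantumLattice Literature.MathematicalPhysics.QuantumFieldTheory
  Literature.Probability.LatticeModels
open Summit.QuantumFields.QCD.Theses.SpectralDefectExtinction

/-! ## §0⁺ Transfer: SD⁺ ⇒ SD, QCDOf ⇒ THR, THR-conj ⇒ bridge -/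

section

variable {Nf : ℕ}

/-- TIGHT⁺ of `SD⁺(N_f)` (verbatim, stmt-18063/18064): TIGHT with floor `max 1 (η (a_k(2L_k+1))²)`. -/
def TightPlus (Nf : ℕ) (reg : QCDRegularisation Nf) (M₀ : ℝ) (m : Fin Nf → ℝ) : Prop :=
  ∃ η : ℝ, 0 < η ∧ ∀ M : ℝ, M₀ < M → ∀ᶠ k : ℕ in Filter.atTop, max 1 (η * (reg.a k * (2 * reg.L k + 1 : ℝ)) ^ 2) ≤ (∫ U, (|(Multiset.countP (fun z : ℂ => z.re < 0) (spinorLift gammaFive * wilsonDirac (fundamentalRep (Fin 3)) U (reg.mcrit k - reg.a k * M / reg.Zm k) 1).charpoly.roots : ℝ) - 6 * (2 * reg.L k + 1 : ℝ) ^ 4|) * ∏ f : Fin Nf, ‖fermionDet (wilsonDirac (fundamentalRep (Fin 3)) U (reg.mcrit k + reg.a k * m f / reg.Zm k) 1)‖ ∂(wilsonMeasure (d := 4) (L := 2 * reg.L k + 1) (fundamentalRep (Fin 3)) (reg.β k))) / (∫ U, ∏ f : Fin Nf, ‖fermionDet (wilsonDirac (fundamentalRep (Fin 3)) U (reg.mcrit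 k + reg.a k * m f / reg.Zm k) 1)‖ ∂(wilsonMeasure (d := 4) (L := 2 * reg.L k + 1) (fundamentalRep (Fin 3)) (reg.β k)))

/-- `SD⁺(N_f)`: hypothesis of the RESTATED bridge (= body of the restated `WindowExtinction`,
stmt-18063): SD + volume cap `∃ p, ∀ᶠ k, L_k ≤ a_k^{-p}` + branch `∀ᶠ k, −1 < m_crit(k)` + TIGHT⁺. -/
def SDPlusHyp (Nf : ℕ) : Prop :=
  ∃ reg : QCDRegularisation Nf, reg.HasMassScaling ∧ (reg.scheme 0 0 0).HasAsymptoticScaling ∧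
    (∃ p : ℕ, ∀ᶠ k : ℕ in Filter.atTop, (reg.L k : ℝ) ≤ (reg.a k)⁻¹ ^ p) ∧ (∀ᶠ k : ℕ in Filter.atTop, -1 < reg.mcrit k) ∧
      ∃ M₀ : ℝ, 0 ≤ M₀ ∧ ∃ c : ℝ, 0 < c ∧ ∀ m : Fin Nf → ℝ, (∀ f, M₀ < m f) → Extinct Nf reg c m ∧ TightPlus Nf reg M₀ m

/-- `THR(N_f)`: conclusion of the restated bridge (massive QCD above a threshold; verbatim). -/
def Threshold (Nf : ℕ) : Prop :=
  ∃ reg : QCDRegularisation Nf, reg.HasMassScaling ∧ ∃ M₁ : ℝ, 0 ≤ M₁ ∧ ∀ m : Fin Nf → ℝ, (∀ f, M₁ < m f) → ∃ (z shift : QCDField Nf → ℕ → ℝ) (T : OSData (QCDField Nf) 4), IsQCDAlong (reg.scheme m z shift) T ∧ T.IsNontrivial QCDField.glue ∧ T.IsNonGaussian QCDField.glue ∧ (∀ f g : Fin Nf, f ≠ g → T.IsNontrivial (QCDField.pseudoRe f g)) ∧ ∃ Δ > 0, T.HasMassGap Δ ∧ (reg.scheme m z shift).HasLatticeMassGap 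Δ

/-- The restated crux unbundled: `ExtinctionBuildsQCD ↔ ∀ N_f ∈ {2,3}, SD⁺(N_f) → THR(N_f)`
(definitional). The root module's `extinctionBuildsQCD_iff` is typed against the RETIRED body. -/
theorem extinctionBuildsQCD_iff_sdPlus :
    ExtinctionBuildsQCD ↔ ∀ Nf : ℕ, (Nf = 2 ∨ Nf = 3) → SDPlusHyp Nf → Threshold Nf := Iff.rfl

/-- The restated sibling crux unbundled: `WindowExtinction ↔ ∀ N_f ∈ {2,3}, SD⁺(N_f)` (definitional). -/
theorem windowExtinction_iff_sdPlus : WindowExtinction ↔ ∀ Nf : ℕ, (Nf = 2 ∨ Nf = 3) → SDPlusHyp Nf :=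
  Iff.rfl

/-- What a kill of the restated crux must exhibit: an SD⁺ witness AND no massive QCD above any
threshold along any mass-scaling regularisation (`¬ THR`, the negation of the threshold form of the
summit conjunct — summit-hard). -/
theorem not_extinctionBuildsQCD_iff_sdPlus :
    ¬ ExtinctionBuildsQCD ↔ ∃ Nf : ℕ, (Nf = 2 ∨ Nf = 3) ∧ SDPlusHyp Nf ∧ ¬ Threshold Nf := by
  rw [extinctionBuildsQCD_iff_sdPlus]
  push Not
  rfl

/-- TIGHT⁺ implies the filed TIGHT (floor `max 1 (η (a(2L+1))²) ≥ 1`). -/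
theorem tight_of_tightPlus {Nf : ℕ} {reg : QCDRegularisation Nf} {M₀ : ℝ} {m : Fin Nf → ℝ}
    (h : TightPlus Nf reg M₀ m) : Tight Nf reg M₀ m := by
  obtain ⟨η, -, h⟩ := h
  intro M hM
  filter_upwards [h M hM] with k hk
  exact le_trans (le_max_left _ _) hk

/-- SD⁺ implies the filed SD: every landed fact about SD-witnesses applies to SD⁺-witnesses. -/
theorem sdHyp_of_sdPlusHyp {Nf : ℕ} (h : SDPlusHyp Nf) : SDHyp Nf := by
  obtain ⟨reg, hms, has, -, -, M₀, hM₀, c, hc, h⟩ := h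
  exact ⟨reg, hms, has, M₀, hM₀, c, hc, fun m hm => ⟨(h m hm).1, tight_of_tightPlus (h m hm).2⟩⟩

/-- The summit conjunct at `N_f` implies the threshold form (threshold `M₁ = 0`; the chiral clause
`IsChiralAtZero` of the re-typed `QCDOf` is simply dropped). -/
theorem threshold_of_qcdOf {Nf : ℕ} (h : QCDOf Nf) : Threshold Nf := by
  obtain ⟨reg, hms, -, hbody⟩ := h
  exact ⟨reg, hms, 0, le_rfl, hbody⟩

/-- The filed hinge follows from the restated one: `WindowExtinction → ∀ N_f ∈ {2,3}, SD(N_f)`. -/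
theorem sdHyp_of_windowExtinction (h : WindowExtinction) {Nf : ℕ} (hNf : Nf = 2 ∨ Nf = 3) : SDHyp Nf :=
  sdHyp_of_sdPlusHyp (h Nf hNf)

/-! ## §2⁺ Load-bearing analysis of the RESTATED crux: of the three new clauses only
TIGHT⁺ separates SD⁺ from junk; without TIGHT⁺ the bridge is its own conclusion `THR 2 ∧ THR 3` -/

variable (Nf) in
/-- `SD⁺(N_f)` with the TIGHT⁺ clause deleted (mass scaling, asymptotic scaling, volume cap,
branch clause and EXTINCT kept). -/
def SDPlusWithoutTight : Prop :=
  ∃ reg : QCDRegularisation Nf, reg.HasMassScaling ∧ (reg.scheme 0 0 0).HasAsymptoticScaling ∧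
    (∃ p : ℕ, ∀ᶠ k : ℕ in Filter.atTop, (reg.L k : ℝ) ≤ (reg.a k)⁻¹ ^ p) ∧
      (∀ᶠ k : ℕ in Filter.atTop, -1 < reg.mcrit k) ∧
        ∃ M₀ : ℝ, 0 ≤ M₀ ∧ ∃ c : ℝ, 0 < c ∧ ∀ m : Fin Nf → ℝ, (∀ f, M₀ < m f) → Extinct Nf reg c m

/-- SD⁺ is `SDPlusWithoutTight` plus TIGHT⁺ (sanity: the deletion is faithful). -/
theorem sdPlusWithoutTight_of_sdPlusHyp (h : SDPlusHyp Nf) : SDPlusWithoutTight Nf := by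
  obtain ⟨reg, h1, h2, hcap, hbr, M₀, hM₀, c, hc, h⟩ := h
  exact ⟨reg, h1, h2, hcap, hbr, M₀, hM₀, c, hc, fun m hm => (h m hm).1⟩

variable (Nf) in
/-- **The junk witness meets the volume cap** (R1) with `p = 2`: `canonicalAF` has
`L_k = (k+1)² = a_k⁻²`. -/
theorem canonicalAF_cap : ∃ p : ℕ, ∀ᶠ k : ℕ in Filter.atTop,
    ((QCDRegularisation.canonicalAF Nf).L k : ℝ) ≤ ((QCDRegularisation.canonicalAF Nf).a k)⁻¹ ^ p :=
  ⟨2, Filter.Eventually.of_forall fun k => by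
    simp [QCDRegularisation.canonicalAF, QCDScheme.zeroAF, SpeciesScheme.zero]⟩

variable (Nf) in
/-- **The junk witness meets the branch clause**: `canonicalAF` has `m_crit ≡ 0 > −1`. -/
theorem canonicalAF_branch : ∀ᶠ k : ℕ in Filter.atTop, -1 < (QCDRegularisation.canonicalAF Nf).mcrit k :=
  Filter.Eventually.of_forall fun _ => by norm_num [QCDRegularisation.canonicalAF]

variable (Nf) in
/-- **Junk witness for SD⁺ minus TIGHT⁺.** `canonicalAF` is mass-scaling, asymptotically scaling,
polynomially capped (`p = 2`), on the physical branch, and satisfies EXTINCT with `M₀ = 0`, `c = 1`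
(its defect integrand vanishes identically, `extinct_of_mcrit_nonneg`). -/
theorem sdPlusWithoutTight_canonicalAF : SDPlusWithoutTight Nf :=
  ⟨QCDRegularisation.canonicalAF Nf, QCDRegularisation.canonicalAF_hasMassScaling,
    QCDScheme.zeroAF_hasAsymptoticScaling, canonicalAF_cap Nf, canonicalAF_branch Nf, 0, le_rfl, 1,
    one_pos, fun m hm => extinct_of_mcrit_nonneg _ (fun _ => le_rfl) le_rfl m hm⟩

/-- The restated crux with TIGHT⁺ deleted from its hypothesis. -/
def ExtinctionBuildsQCDPlusWithoutTight : Prop :=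
  ∀ Nf : ℕ, (Nf = 2 ∨ Nf = 3) → SDPlusWithoutTight Nf → Threshold Nf

/-- **LOAD-BEARING (restated crux): without TIGHT⁺ the bridge IS its conclusion `THR 2 ∧ THR 3`.**
Any proof of `ExtinctionBuildsQCD` must use the extensive pin; the volume cap, the branch clause,
EXTINCT (sign AND coercivity counts, any `c ≤ 1`), mass scaling and asymptotic scaling together carry
no information. -/
theorem extinctionBuildsQCDPlusWithoutTight_iff_threshold :
    ExtinctionBuildsQCDPlusWithoutTight ↔ Threshold 2 ∧ Threshold 3 :=
  ⟨fun h => ⟨h 2 (Or.inl rfl) (sdPlusWithoutTight_canonicalAF 2),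
      h 3 (Or.inr rfl) (sdPlusWithoutTight_canonicalAF 3)⟩,
    fun hq Nf hNf _ => by
      rcases hNf with rfl | rfl
      exacts [hq.1, hq.2]⟩

/-- **Collapse schema for candidate repairs of TIGHT⁺ (restated crux).** Replacing TIGHT⁺ by ANY
side condition `P` that the degenerate witness `canonicalAF` happens to satisfy — on top of the
cap and the branch clause — still yields a statement equivalent to `THR 2 ∧ THR 3`. -/
theorem bridgePlus_collapse_schema (P : ∀ Nf : ℕ, QCDRegularisation Nf → Prop)
    (hP : ∀ Nf, P Nf (QCDRegularisation.canonicalAF Nf)) :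
    (∀ Nf : ℕ, (Nf = 2 ∨ Nf = 3) →
      (∃ reg : QCDRegularisation Nf, P Nf reg ∧ reg.HasMassScaling ∧
        (reg.scheme 0 0 0).HasAsymptoticScaling ∧
          (∃ p : ℕ, ∀ᶠ k : ℕ in Filter.atTop, (reg.L k : ℝ) ≤ (reg.a k)⁻¹ ^ p) ∧
            (∀ᶠ k : ℕ in Filter.atTop, -1 < reg.mcrit k) ∧ ∃ M₀ : ℝ, 0 ≤ M₀ ∧ ∃ c : ℝ, 0 < c ∧
              ∀ m : Fin Nf → ℝ, (∀ f, M₀ < m f) → Extinct Nf reg c m) → Threshold Nf) ↔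
      Threshold 2 ∧ Threshold 3 := by
  have hw : ∀ Nf, ∃ reg : QCDRegularisation Nf, P Nf reg ∧ reg.HasMassScaling ∧
      (reg.scheme 0 0 0).HasAsymptoticScaling ∧
        (∃ p : ℕ, ∀ᶠ k : ℕ in Filter.atTop, (reg.L k : ℝ) ≤ (reg.a k)⁻¹ ^ p) ∧
          (∀ᶠ k : ℕ in Filter.atTop, -1 < reg.mcrit k) ∧ ∃ M₀ : ℝ, 0 ≤ M₀ ∧ ∃ c : ℝ, 0 < c ∧
            ∀ m : Fin Nf → ℝ, (∀ f, M₀ < m f) → Extinct Nf reg c m := fun Nf =>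
    ⟨QCDRegularisation.canonicalAF Nf, hP Nf, QCDRegularisation.canonicalAF_hasMassScaling,
      QCDScheme.zeroAF_hasAsymptoticScaling, canonicalAF_cap Nf, canonicalAF_branch Nf, 0, le_rfl, 1,
      one_pos, fun m hm => extinct_of_mcrit_nonneg _ (fun _ => le_rfl) le_rfl m hm⟩
  exact ⟨fun h => ⟨h 2 (Or.inl rfl) (hw 2), h 3 (Or.inr rfl) (hw 3)⟩,
    fun hq Nf hNf _ => by
      rcases hNf with rfl | rfl
      exacts [hq.1, hq.2]⟩

/-- **The crux sandwiched**: `THR 2 ∧ THR 3 → ExtinctionBuildsQCD → (WindowExtinction → THR 2 ∧ THR 3)`.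
Given the sibling crux (by ANY witnesses) the bridge is EQUIVALENT to its conclusion; what keeps
it from being its conclusion outright is exactly the absence of a junk inhabitant of SD⁺, i.e. the
extensive pin TIGHT⁺ under the cap (`extinctionBuildsQCDPlusWithoutTight_iff_threshold`). -/
theorem extinctionBuildsQCD_iff_threshold_of_windowExtinction (hSD : WindowExtinction) :
    ExtinctionBuildsQCD ↔ Threshold 2 ∧ Threshold 3 :=
  ⟨fun h => ⟨h 2 (Or.inl rfl) (hSD 2 (Or.inl rfl)), h 3 (Or.inr rfl) (hSD 3 (Or.inr rfl))⟩,
    fun hq Nf hNf _ => by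
      rcases hNf with rfl | rfl
      exacts [hq.1, hq.2]⟩

end

end Summit.QuantumFields.QCD.Theorems.ExtinctionBuildsQCD.Negative

end
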